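import Literature.AnabelianGeometry.EtaleTheta.Discharge.Sec5OfThetaSettingAug
import Literature.AnabelianGeometry.EtaleTheta.Discharge.Sec5OriginClausesOfPushforward

/-!
# [EtTh] §5 data OF THE SETTING: the «origin clauses» `hΔcnst` / `hcnst` / `hconstΔ` with their Π-side inputs DISCHARGED
# (§3 p.298, §5 p.322, Lem 5.8 p.331, Thm 5.6 proof p.329 / PDF pp.72, 96, 105, 103)

Mochizuki, *The étale theta function …*, Publ. RIMS **45** (2009), §3 p.298 (PDF p.72): "the natural surjection `Π^tp_X ↠ G_K` determines a
natural functor `D₀ → D^cnst`"; §5 p.322 (PDF p.96): "geometrically connected over the field `K = K̈`".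
[cite: MochizukiEtTh2009, §3 p.298 (PDF p.72); §5 p.322 (PDF p.96); Lem 5.8 p.331 (PDF p.105)]

abc-iut cell, layer L2, seat abc-iut-L2-t4 (§5 owner, gen 4), ROW W3-L2-01; PROOF-ONLY knit (no definition; nothing landed is edited) of
abc-iut-w4-d008's `Discharge/Sec5OriginClausesOfPushforward.lean` (p433787: `hΔcnst`, `hcnst`, `hconstΔ` at the genuine §5 data over
`B^temp(Π^tp_X)⁰` for ANY identification `e : tf.base ⋙ cnst ≅ aug_* ⋙ G` of `D → D₀ → D^cnst` with the push-forward along an OPEN augmentation,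
modulo the Π-side inputs `haug`, `hYdd`, `hker`) with this seat's §5 data OF THE SETTING (`Sec5OfThetaSetting.lean` p433549,
`Sec5OfThetaSettingAug.lean` p436226).  AT THE SETTING the three Π-side inputs are THEOREMS:
* `haug := isOpenMap_aug_temperedArithmeticGroup C e` (open mapping theorem for tempered groups);
* `hYdd` ⟸ `map_aug_thetaEnvData_PiYdd_eq_top` («`Π^tp_Ÿ̲̲ ↠ Gal(K̄/K)`», t8's field `map_aug_Ydduu`) — `hYdd_ofThetaSetting`;
* `hker` («`Ker(T.aug)` is geometric for `X.aug`») — `hker_ofThetaSetting`: the two augmentations COINCIDE through `e.galEquiv`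
  (`temperedArithmeticGroup_aug_eq`).
RESULTS (residual inputs: the functor `cnst : D₀ ⥤ D^cnst`, `G`, the identification `e'`, and — for `hconstΔ` — abc-iut-L2-t3's `Prop34Cnst T₀ cnst`):
`cnst_map_base_rho_eq_of_aug_eq_ofThetaSetting`, `hΔcnst_ofThetaSettingData` (`cnst(base(ρ_N δ)) = id` for geometric `δ`),
`hcnst_ofThetaSettingData`, `hconstΔ_ofThetaSettingData`.
HONEST FRAMING: kernel-checked composition; `tf`, `cnst`, `e'`, `Prop34Cnst` stay abstract inputs; nothing of [EtTh] is asserted unconditionally;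
no side taken on [IUTchIII] Cor. 3.12; typed ≠ proved.
-/

noncomputable section

namespace Literature.AnabelianGeometry.EtaleTheta

open CategoryTheory Opposite Literature.AlgebraicGeometry.Frobenioids Literature.AlgebraicGeometry.Frobenioids.QuasiTemperoid
  Literature.AnabelianGeometry.SemiGraphs Literature.AnabelianGeometry.SemiGraphs.GaloisObjects
  Literature.AlgebraicGeometry.Frobenioids.QuasiTemperoid.BTempConnected

universe v₀ u₁ v₁

/-! ### The Π-side inputs at the Setting -/

namespace ThetaSetting.EtaleThetaData.DoubleUnderline

variable {p : ℕ} [Fact p.Prime] {D : ThetaSetting p} {E : D.EtaleThetaData} {l : ℕ} (C : E.DoubleUnderline l)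
  (e : D.toTemperedCurve.GroupLevelData) {N : ℕ+} (μ : D.CyclotomeMod l N) (hC : D.Compat) (hS : D.Sec2Hyps)

/-- **`hYdd` at the Setting**: every `y ∈ Π^tp_X̲̲` has the same image in `Gal(K̄/K)` as some `k ∈ Π^tp_Ÿ̲̲` («`Ÿ̲̲` geometrically connected
over `K = K̈`», §5 p.322).  [cite: MochizukiEtTh2009, §5 p.322 (PDF p.96)] -/
theorem hYdd_ofThetaSetting (y : (C.thetaEnvData μ hC hS).PiX) :
    ∃ k ∈ (C.thetaEnvData μ hC hS).PiYdd,
      (C.temperedArithmeticGroup e).aug ((ContinuousMulEquiv.refl _) k) = (C.temperedArithmeticGroup e).aug ((ContinuousMulEquiv.refl _) y) := by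
  have hy : (C.temperedArithmeticGroup e).aug y ∈ ((C.thetaEnvData μ hC hS).PiYdd).map (C.temperedArithmeticGroup e).aug.toMonoidHom := by
    rw [C.map_aug_thetaEnvData_PiYdd_eq_top e μ hC hS]; trivial
  obtain ⟨k, hk, hky⟩ := hy
  exact ⟨k, hk, hky⟩

/-- **`hker` at the Setting**: the kernel of the §2 datum's augmentation `T.aug : Π^tp_X̲̲ → G_K` is killed by the Ex. 3.10 augmentation
`X.aug : Π^tp_X̲̲ → Gal(K̄/K)` — the two coincide through `e.galEquiv` (`temperedArithmeticGroup_aug_eq`).  [cite: MochizukiEtTh2009, Def 2.13 p.273 (PDF p.47)] -/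
theorem hker_ofThetaSetting :
    ∀ δ ∈ (C.thetaEnvData μ hC hS).aug.ker, (C.temperedArithmeticGroup e).aug ((ContinuousMulEquiv.refl _) δ) = 1 := by
  intro δ hδ
  rw [MonoidHom.mem_ker] at hδ
  change (C.temperedArithmeticGroup e).aug δ = 1
  rw [C.temperedArithmeticGroup_aug_eq e μ hC hS, hδ, map_one]

end ThetaSetting.EtaleThetaData.DoubleUnderline

/-! ### The origin clauses at the §5 data of the Setting -/

namespace ThetaFrobenioid

variable {p : ℕ} [Fact p.Prime] {D : ThetaSetting p} {E : D.EtaleThetaData} {l : ℕ} {C : E.DoubleUnderline l}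
  {e : D.toTemperedCurve.GroupLevelData} {N : ℕ+} (μ : D.CyclotomeMod l N) (hC : D.Compat) (hS : D.Sec2Hyps)
  {D₀ : Type} [Category.{v₀} D₀] {V : FrdIMonoidStub.{0}} {T₀ : RealifiedDivisorMonoids (D₀ := D₀) V}
  {VD : FrdICatStub.{1, 0, 0} (ConnectedPart (BTemp (C.temperedArithmeticGroup e).Pi))}
  {tf : TemperedFrobenioid T₀ (ConnectedPart (BTemp (C.temperedArithmeticGroup e).Pi)) VD} {hZ : tf.monoidType = MonoidType.Z}
  {hP : ∀ A : (ConnectedPart (BTemp (C.temperedArithmeticGroup e).Pi))ᵒᵖ, IsPerfect (tf.Φ.carrier A)}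
  {NH : Subgroup (Field.absoluteGaloisGroup D.K) → tf.category → ℕ+ → Prop} {A₀ : tf.category}
  {hA₀ : PreFrobenioid.IsFrobeniusTrivial tf.toElem A₀} {hA₀' : SemiGraphs.IsGaloisObj A₀.base.obj}
  {pullFrac : ∀ {A A' : (BiKummerSetting.mkOfConnectedTemperoid (C.temperedArithmeticGroup e) tf hZ hP NH A₀ hA₀ hA₀').C} (_ : A' ⟶ A),
    (BiKummerSetting.mkOfConnectedTemperoid (C.temperedArithmeticGroup e) tf hZ hP NH A₀ hA₀ hA₀').biratUnits A →
      (BiKummerSetting.mkOfConnectedTemperoid (C.temperedArithmeticGroup e) tf hZ hP NH A₀ hA₀ hA₀').biratUnits A'}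
  {θ : (BiKummerSetting.mkOfConnectedTemperoid (C.temperedArithmeticGroup e) tf hZ hP NH A₀ hA₀ hA₀').biratUnits
    (BiKummerSetting.mkOfConnectedTemperoid (C.temperedArithmeticGroup e) tf hZ hP NH A₀ hA₀ hA₀').Aodot}
  {Bl : (BiKummerSetting.mkOfConnectedTemperoid (C.temperedArithmeticGroup e) tf hZ hP NH A₀ hA₀ hA₀').C}
  {Pl : (BiKummerSetting.mkOfConnectedTemperoid (C.temperedArithmeticGroup e) tf hZ hP NH A₀ hA₀ hA₀').FractionPair θ Bl}
  {Rl : (BiKummerSetting.mkOfConnectedTemperoid (C.temperedArithmeticGroup e) tf hZ hP NH A₀ hA₀ hA₀').NthRoot θ Pl C.lPNat pullFrac}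
  (h : ModelFrobenioid.Hypotheses tf.divisorMonoid tf.ratFnFunctor)
  (Q : FrobenioidTheta.ThetaSubquotientStub.{0} (ConnectedPart (BTemp (C.temperedArithmeticGroup e).Pi)))
  (R : (BiKummerSetting.mkOfConnectedTemperoid (C.temperedArithmeticGroup e) tf hZ hP NH A₀ hA₀ hA₀').NthRoot Rl.root Rl.pair N pullFrac)
  (K' : Type) [Field K'] (constEmb : K'ˣ →* tf.biratUnitsModel R.BN) (constEmb_injective : Function.Injective constEmb)
  (hinvc : ∀ g : Aut R.AN.base,
    pull tf.divisorMonoid g.hom (ModelFrobenioid.div R.pair.num) = ModelFrobenioid.div R.pair.num)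
  (hinvp : ∀ y : (C.thetaEnvData μ hC hS).PiX, y ∈ (C.thetaEnvData μ hC hS).PiYdd →
    pull tf.divisorMonoid ((BiKummerSetting.mkOfConnectedTemperoid (C.temperedArithmeticGroup e) tf hZ hP NH A₀ hA₀ hA₀').galoisSurj
      R.AN.base R.αData.isGalois ((ContinuousMulEquiv.refl _) y)).hom (ModelFrobenioid.div R.pair.den) = ModelFrobenioid.div R.pair.den)
  {Dcnst : Type u₁} [Category.{v₁} Dcnst] (cnst : D₀ ⥤ Dcnst)
  (G : ConnectedPart (BTemp (Field.absoluteGaloisGroup D.K)) ⥤ Dcnst)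
  (e' : tf.base ⋙ cnst ≅
    QuasiTemperoid.pushforward (C.temperedArithmeticGroup e).aug.toMonoidHom (C.temperedArithmeticGroup e).aug_surjective
      (C.isOpenMap_aug_temperedArithmeticGroup e) ⋙ G)

include e' in
/-- **`D → D₀ → D^cnst` only sees the augmentation, at the Setting**: `aug y = aug y'` ⇒ `cnst(base(ρ_N y)) = cnst(base(ρ_N y'))`
(abc-iut-w4-d008's `cnst_map_base_rho_eq_of_aug_eq` with `haug` DISCHARGED, `ιX := id`).  [cite: MochizukiEtTh2009, §3 p.298 (PDF p.72); §5 p.331 (PDF p.105)] -/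
theorem cnst_map_base_rho_eq_of_aug_eq_ofThetaSetting {y y' : C.Huu}
    (hyy' : (C.temperedArithmeticGroup e).aug y = (C.temperedArithmeticGroup e).aug y') :
    cnst.map (tf.base.map ((ofThetaSettingData μ hC hS h Q R K' constEmb constEmb_injective hinvc hinvp).ρ y).hom) =
      cnst.map (tf.base.map ((ofThetaSettingData μ hC hS h Q R K' constEmb constEmb_injective hinvc hinvp).ρ y').hom) :=
  cnst_map_base_rho_eq_of_aug_eq (T := C.thetaEnvData μ hC hS) R (ContinuousMulEquiv.refl _) (C.isOpenMap_aug_temperedArithmeticGroup e)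
    cnst G e' hyy'

include e' in
/-- **`hΔcnst` at the Setting** (abc-iut-w5-d020's origin clause, GAP G-w5d020-2): for `δ ∈ Π^tp_X̲̲` GEOMETRIC (`aug δ = 1`), `ρ_N(δ)` maps to
the identity of `(B_N^bs)^cnst`.  [cite: MochizukiEtTh2009, §3 p.298 (PDF p.72); Thm 5.6 proof p.329 (PDF p.103)] -/
theorem hΔcnst_ofThetaSettingData {δ : C.Huu} (hδ : (C.temperedArithmeticGroup e).aug δ = 1) :
    cnst.map (tf.base.map ((ofThetaSettingData μ hC hS h Q R K' constEmb constEmb_injective hinvc hinvp).ρ δ).hom) =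
      𝟙 (cnst.obj (tf.base.obj R.BN.base)) :=
  cnst_map_base_rho_eq_id_of_aug_eq_one (T := C.thetaEnvData μ hC hS) R (ContinuousMulEquiv.refl _)
    (C.isOpenMap_aug_temperedArithmeticGroup e) cnst G e' hδ

include e' in
/-- **`hcnst` at the Setting, `hYdd` DISCHARGED** (residual of GAP G-L2d4-1 after p432786): every `y ∈ Im(Π^tp_Y̲̲)` has the same image in
`Aut_{D^cnst}((B_N^bs)^cnst)` as some `h ∈ H_{B_N} = Im(Π^tp_Ÿ̲̲)`.  [cite: MochizukiEtTh2009, §5 p.322 (PDF p.96); Lem 5.8 p.331 (PDF p.105)] -/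
theorem hcnst_ofThetaSettingData :
    ∀ y ∈ (ofThetaSettingData μ hC hS h Q R K' constEmb constEmb_injective hinvc hinvp).imPiY,
      ∃ k ∈ (ofThetaSettingData μ hC hS h Q R K' constEmb constEmb_injective hinvc hinvp).HB,
        cnst.map (tf.base.map y.hom) = cnst.map (tf.base.map k.hom) :=
  hcnst_ofConnectedTemperoidData_of_pushforward (T := C.thetaEnvData μ hC hS) h Q C.odd_lPNat R (ContinuousMulEquiv.refl _) K'
    constEmb constEmb_injective hinvc hinvp (C.isOpenMap_aug_temperedArithmeticGroup e) cnst G e' (C.hYdd_ofThetaSetting e μ hC hS)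

include e' in
/-- **`hconstΔ` at the Setting, `hker` DISCHARGED** (abc-iut-w5-d020's T56-L09b binder `hconst`: GEOMETRIC `δ` fix the rational-function
component of every unit of `B_N`), from abc-iut-L2-t3's `Prop34Cnst T₀ cnst` and the identification `e'`.
[cite: MochizukiEtTh2009, Prop 3.4 (ii) p.300 (PDF p.74); Thm 5.6 proof p.329 (PDF p.103)] -/
theorem hconstΔ_ofThetaSettingData (hP34 : RealifiedDivisorMonoids.Prop34Cnst T₀ cnst) :
    ∀ δ ∈ (C.thetaEnvData μ hC hS).aug.ker, ∀ τ : ModelFrobenioid.units R.BN,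
      (tf.ratFnFunctor.map ((ofThetaSettingData μ hC hS h Q R K' constEmb constEmb_injective hinvc hinvp).ρ δ).hom.op).hom
          (ModelFrobenioid.unit τ.1.hom) = ModelFrobenioid.unit τ.1.hom :=
  hconstΔ_ofConnectedTemperoidData_of_pushforward (T := C.thetaEnvData μ hC hS) h R (ContinuousMulEquiv.refl _)
    (C.isOpenMap_aug_temperedArithmeticGroup e) cnst G e' hP34 (C.hker_ofThetaSetting e μ hC hS)

end ThetaFrobenioid

end Literature.AnabelianGeometry.EtaleTheta

end
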